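import Mathlib.LinearAlgebra.Matrix.ToLin
import Mathlib.LinearAlgebra.Matrix.Adjugate
import Mathlib.LinearAlgebra.Matrix.AbsoluteValue
import Mathlib.LinearAlgebra.Matrix.DotProduct
import Mathlib.LinearAlgebra.Matrix.NonsingularInverse
import Mathlib.Data.Nat.Factorial.Basic
import HarnessLib

/-!
# Small integer solutions of homogeneous linear systems with a prescribed nonzero coordinate

Topic `Literature/LinearAlgebra/Matrix`. Let `A` be an `m × p` integer matrix with entries of
absolute value `≤ H`, and suppose the system `A x = 0` has a RATIONAL solution with `x_{k₀} ≠ 0`.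
Then it has an INTEGER solution `y` with `y_{k₀} ≠ 0` and **`|y_k| ≤ p! · (m H² + 1)^p`**
(`exists_small_int_kernel_vector`). (Siegel's lemma, Mathlib's `Int.Matrix.exists_ne_zero_int_vec_norm_le`,
gives a smaller nonzero solution, but cannot prescribe which coordinate is nonzero.) Proof: take a
solution with `x_{k₀} = 1` of minimal support; then the columns of `A` on the rest `J` of the
support are linearly independent (`linearIndependent_cols_of_minimal_support`), so the Gram
matrix `G = A_Jᵀ A_J` is an invertible integer matrix, `G x_J = A_Jᵀ b` with `b = -A^{k₀}`, and
`y = det G · x`, i.e. `y_{k₀} = det G`, `y_J = adj(G) A_Jᵀ b`, is integral with the stated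
Hadamard-type bounds (`Matrix.det_le`). This is the height control needed when an ideal-membership
certificate known to exist over `ℚ` (e.g. from an effective Nullstellensatz) has to be realised
with small integer coefficients.

## Contents (namespace `Literature.LinearAlgebra.Matrix`, everything proved)

* `supp`, `mulVec_eq_sum_col` — bookkeeping;
* `linearIndependent_cols_of_minimal_support` — minimal support ⟹ independent columns;
* `abs_adjugate_le`, `abs_adjugate_mulVec_le` — Hadamard-type bounds;
* `exists_small_int_kernel_vector` — the statement above.
-/

noncomputable section

open Finset
open scoped Classical

namespace Literature.LinearAlgebra.Matrix

variable {m p : ℕ}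

/-- The support of a vector. [folklore] -/
def supp {R : Type*} [Zero R] (x : Fin p → R) : Finset (Fin p) := univ.filter fun k => x k ≠ 0

/-- Membership in the support. [folklore] -/
theorem mem_supp {R : Type*} [Zero R] {x : Fin p → R} {k : Fin p} : k ∈ supp x ↔ x k ≠ 0 := by
  simp [supp]

/-- `A x = ∑_k x_k A^k`. [folklore] -/
theorem mulVec_eq_sum_col {R : Type*} [CommRing R] {ι : Type*} [Fintype ι] (A : Matrix (Fin m) ι R)
    (v : ι → R) : A.mulVec v = ∑ k, v k • A.col k := by
  ext i
  simp only [Matrix.mulVec, dotProduct, Finset.sum_apply, Pi.smul_apply, smul_eq_mul,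
    Matrix.col_apply, mul_comm]

/-- **Minimal support gives independent columns.** If `x` solves `A x = 0`, `x_{k₀} = 1`, and has
minimal support among such solutions, then the columns of `A` indexed by `supp x ∖ {k₀}` are
linearly independent (otherwise a kernel vector supported there could be subtracted to shrink the
support). [folklore] -/
theorem linearIndependent_cols_of_minimal_support {K : Type*} [Field K]
    (A : Matrix (Fin m) (Fin p) K) (k₀ : Fin p) (x : Fin p → K) (hx : A.mulVec x = 0)
    (hx0 : x k₀ = 1)
    (hmin : ∀ x' : Fin p → K, A.mulVec x' = 0 → x' k₀ = 1 → (supp x).card ≤ (supp x').card) :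
    LinearIndependent K (fun k : ((supp x).erase k₀ : Finset (Fin p)) => A.col k) := by
  set J := (supp x).erase k₀ with hJ
  by_contra hdep
  obtain ⟨c, hc, k₁, hk₁⟩ := Fintype.not_linearIndependent_iff.1 hdep
  -- extend `c` by zero
  set c' : Fin p → K := fun k => if h : k ∈ J then c ⟨k, h⟩ else 0 with hc'
  have hc'J : ∀ k (h : k ∈ J), c' k = c ⟨k, h⟩ := fun k h => by simp [hc', h]
  have hc'out : ∀ k, k ∉ J → c' k = 0 := fun k h => by simp [hc', h]
  have hAc' : A.mulVec c' = 0 := by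
    rw [mulVec_eq_sum_col,
      ← Finset.sum_subset (Finset.subset_univ J) (fun k _ hk => by rw [hc'out k hk, zero_smul]),
      ← Finset.sum_coe_sort J, ← hc]
    exact Finset.sum_congr rfl fun k _ => by rw [hc'J k k.2]
  have hk₁J : (k₁ : Fin p) ∈ J := k₁.2
  have hk₁supp : (k₁ : Fin p) ∈ supp x := Finset.mem_of_mem_erase hk₁J
  have hck₁ : c' k₁ ≠ 0 := by rw [hc'J _ k₁.2]; exact hk₁
  -- the shifted solution
  set r := x k₁ / c' k₁ with hr
  set x' : Fin p → K := x - r • c' with hx'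
  have hAx' : A.mulVec x' = 0 := by
    rw [hx', Matrix.mulVec_sub, Matrix.mulVec_smul, hx, hAc', smul_zero, sub_zero]
  have hk₀J : k₀ ∉ J := Finset.notMem_erase k₀ _
  have hx'k₀ : x' k₀ = 1 := by simp [hx', hc'out k₀ hk₀J, hx0]
  have hsub : supp x' ⊆ supp x := by
    intro k hk
    rw [mem_supp] at hk ⊢
    intro hxk
    apply hk
    have hkJ : k ∉ J := fun h => by
      have := Finset.mem_of_mem_erase h
      rw [mem_supp] at this; exact this hxk
    simp [hx', hxk, hc'out k hkJ]
  have hx'k₁ : x' k₁ = 0 := by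
    simp only [hx', Pi.sub_apply, Pi.smul_apply, smul_eq_mul, hr]
    rw [div_mul_cancel₀ _ hck₁, sub_self]
  have hssub : supp x' ⊂ supp x :=
    (Finset.ssubset_iff_of_subset hsub).2 ⟨k₁, hk₁supp, by rw [mem_supp]; exact fun h => h hx'k₁⟩
  exact absurd (Finset.card_lt_card hssub) (not_lt.2 (hmin x' hAx' hx'k₀))

/-! ### Hadamard-type bounds -/

/-- Entries of the adjugate of an integer matrix with entries bounded by `X ≥ 1` are bounded by
`r! X^r`. [folklore] -/
theorem abs_adjugate_le {ι : Type*} [Fintype ι] [DecidableEq ι] (G : Matrix ι ι ℤ) {X : ℤ}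
    (hX1 : 1 ≤ X) (hG : ∀ i j, |G i j| ≤ X) (i j : ι) :
    |G.adjugate i j| ≤ (Fintype.card ι).factorial * X ^ Fintype.card ι := by
  rw [Matrix.adjugate_apply]
  have h := Matrix.det_le (abv := AbsoluteValue.abs) (A := G.updateRow j (Pi.single i 1)) (x := X)
    (fun a b => by
      rw [AbsoluteValue.abs_apply, Matrix.updateRow_apply]
      split_ifs with h
      · by_cases hb : b = i
        · subst hb; simp; exact hX1
        · rw [Pi.single_eq_of_ne hb, abs_zero]; exact le_trans zero_le_one hX1
      · exact hG a b)
  rw [AbsoluteValue.abs_apply, nsmul_eq_mul] at h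
  exact h

/-- `|det G| ≤ r! X^r`. [folklore] -/
theorem abs_det_le {ι : Type*} [Fintype ι] [DecidableEq ι] (G : Matrix ι ι ℤ) {X : ℤ}
    (hG : ∀ i j, |G i j| ≤ X) : |G.det| ≤ (Fintype.card ι).factorial * X ^ Fintype.card ι := by
  have h := Matrix.det_le (abv := AbsoluteValue.abs) (A := G) (x := X)
    (fun a b => by rw [AbsoluteValue.abs_apply]; exact hG a b)
  rw [AbsoluteValue.abs_apply, nsmul_eq_mul] at h
  exact h

/-- `|∑_i u_i v_i| ≤ r U V`. [folklore] -/
theorem abs_dotProduct_le {ι : Type*} [Fintype ι] (u v : ι → ℤ) {U V : ℤ} (hU : ∀ i, |u i| ≤ U)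
    (hV : ∀ i, |v i| ≤ V) : |u ⬝ᵥ v| ≤ Fintype.card ι * (U * V) := by
  unfold dotProduct
  refine (Finset.abs_sum_le_sum_abs _ _).trans ?_
  calc ∑ i, |u i * v i| ≤ ∑ _i : ι, U * V := Finset.sum_le_sum fun i _ => by
        rw [abs_mul]; exact mul_le_mul (hU i) (hV i) (abs_nonneg _) ((abs_nonneg _).trans (hU i))
    _ = Fintype.card ι * (U * V) := by rw [Finset.sum_const, Finset.card_univ, nsmul_eq_mul]

/-! ### The main statement -/

/-- **Small integer kernel vectors with a prescribed nonzero coordinate.** Let `A` be an `m × p`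
integer matrix with `|A_{ij}| ≤ H`, and suppose some rational `x` with `A x = 0` has `x_{k₀} ≠ 0`.
Then there is an integer `y` with `A y = 0`, `y_{k₀} ≠ 0` and
`|y_k| ≤ p! (m H² + 1)^p` for all `k`. (Minimal support, Gram matrix, adjugate; see the module
docstring.) [folklore] -/
theorem exists_small_int_kernel_vector (A : Matrix (Fin m) (Fin p) ℤ) {H : ℕ}
    (hH : ∀ i j, |A i j| ≤ (H : ℤ)) (k₀ : Fin p)
    (hsol : ∃ x : Fin p → ℚ, (A.map (Int.castRingHom ℚ)).mulVec x = 0 ∧ x k₀ ≠ 0) :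
    ∃ y : Fin p → ℤ, A.mulVec y = 0 ∧ y k₀ ≠ 0 ∧
      ∀ k, |y k| ≤ p.factorial * ((m : ℤ) * H ^ 2 + 1) ^ p := by
  set Aq : Matrix (Fin m) (Fin p) ℚ := A.map (Int.castRingHom ℚ) with hAq
  -- a solution with `x k₀ = 1` of minimal support
  have hP : ∃ t, ∃ x : Fin p → ℚ, Aq.mulVec x = 0 ∧ x k₀ = 1 ∧ (supp x).card ≤ t := by
    obtain ⟨x, hx, hx0⟩ := hsol
    refine ⟨p, (x k₀)⁻¹ • x, ?_, by simp [hx0], ?_⟩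
    · rw [Matrix.mulVec_smul, hx, smul_zero]
    · exact (Finset.card_le_univ _).trans (by rw [Fintype.card_fin])
  obtain ⟨x, hx, hx0, hxt⟩ := Nat.find_spec hP
  have hmin : ∀ x' : Fin p → ℚ, Aq.mulVec x' = 0 → x' k₀ = 1 → (supp x).card ≤ (supp x').card := by
    intro x' hx' hx'0
    by_contra hlt
    push Not at hlt
    have := Nat.find_min hP (m := (supp x').card) (by omega)
    exact this ⟨x', hx', hx'0, le_rfl⟩
  have hk₀supp : k₀ ∈ supp x := by rw [mem_supp, hx0]; exact one_ne_zero
  -- independent columns on `J`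
  set J : Finset (Fin p) := (supp x).erase k₀ with hJ
  have hli := linearIndependent_cols_of_minimal_support Aq k₀ x hx hx0 hmin
  rw [← hJ] at hli
  -- integer data
  set AJ : Matrix (Fin m) J ℤ := A.submatrix id (fun k : J => (k : Fin p)) with hAJ
  set G : Matrix J J ℤ := AJ.transpose * AJ with hG
  set b : Fin m → ℤ := fun i => -A i k₀ with hb
  set cv : J → ℤ := AJ.transpose.mulVec b with hcv
  set B : Matrix (Fin m) J ℚ := Aq.submatrix id (fun k : J => (k : Fin p)) with hB
  have hBmap : B = AJ.map (Int.castRingHom ℚ) := by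
    ext i k; simp [hB, hAJ, hAq]
  have hBcol : B.col = fun k : J => Aq.col (k : Fin p) := by
    ext k i; simp [hB, Matrix.col_apply]
  -- `B` is injective, so the Gram matrix is invertible
  have hBinj : Function.Injective B.mulVec := by
    rw [Matrix.mulVec_injective_iff, hBcol]; exact hli
  set Gq : Matrix J J ℚ := G.map (Int.castRingHom ℚ) with hGq
  have hGqBB : Gq = B.transpose * B := by
    rw [hGq, hG, Matrix.map_mul, Matrix.transpose_map, hBmap]
  have hGqinj : Function.Injective Gq.mulVec := by
    intro v w hvw
    have h0 : Gq.mulVec (v - w) = 0 := by rw [Matrix.mulVec_sub, hvw, sub_self]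
    have h1 : B.mulVec (v - w) ⬝ᵥ B.mulVec (v - w) = 0 := by
      have h2 : (v - w) ⬝ᵥ Gq.mulVec (v - w) = 0 := by rw [h0, dotProduct_zero]
      rw [hGqBB, ← Matrix.mulVec_mulVec, Matrix.dotProduct_mulVec, Matrix.vecMul_transpose] at h2
      exact h2
    rw [dotProduct_self_eq_zero] at h1
    have h3 : v - w = 0 := hBinj (by rw [h1, Matrix.mulVec_zero])
    exact sub_eq_zero.1 h3
  have hGqunit : IsUnit Gq := Matrix.mulVec_injective_iff_isUnit.1 hGqinj
  have hdetq : Gq.det ≠ 0 := ((Matrix.isUnit_iff_isUnit_det _).1 hGqunit).ne_zero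
  have hdetG : (G.det : ℚ) = Gq.det := by
    rw [hGq, ← RingHom.mapMatrix_apply, ← RingHom.map_det, eq_intCast]
  have hdet0 : G.det ≠ 0 := fun h => hdetq (by rw [← hdetG, h, Int.cast_zero])
  -- the equations on `J`
  set xJ : J → ℚ := fun k => x (k : Fin p) with hxJ
  have hBx : B.mulVec xJ = fun i => ((b i : ℤ) : ℚ) := by
    ext i
    have hi := congrFun hx i
    simp only [Matrix.mulVec, dotProduct, Pi.zero_apply] at hi
    -- restrict the sum to the support, then split off `k₀`
    rw [← Finset.sum_subset (Finset.subset_univ (supp x)) (fun k _ hk => by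
      rw [mem_supp, not_not] at hk; rw [hk, mul_zero]), ← Finset.add_sum_erase _ _ hk₀supp,
      hx0, mul_one] at hi
    have : ∑ k ∈ J, Aq i k * x k = -Aq i k₀ := by rw [hJ]; linarith
    simp only [Matrix.mulVec, dotProduct, hB, Matrix.submatrix_apply, id, hb, Int.cast_neg]
    rw [Finset.sum_coe_sort J (fun k => Aq i k * x k)]
    rw [this, hAq, Matrix.map_apply, eq_intCast]
  have hGx : Gq.mulVec xJ = fun k => ((cv k : ℤ) : ℚ) := by
    rw [hGqBB, ← Matrix.mulVec_mulVec, hBx, hcv, hBmap]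
    have : (fun i => ((b i : ℤ) : ℚ)) = (Int.castRingHom ℚ) ∘ b := rfl
    rw [this, ← Matrix.transpose_map]
    funext k
    rw [← RingHom.map_mulVec, eq_intCast]
  have hdetx : ∀ k : J, (G.det : ℚ) * x k = (((G.adjugate.mulVec cv) k : ℤ) : ℚ) := by
    intro k
    have h1 : Gq.det • xJ = Gq.adjugate.mulVec (Gq.mulVec xJ) := by
      rw [Matrix.mulVec_mulVec, Matrix.adjugate_mul, Matrix.smul_mulVec, Matrix.one_mulVec]
    have h2 := congrFun h1 k
    rw [Pi.smul_apply, smul_eq_mul, hGx] at h2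
    rw [hdetG, show x (k : Fin p) = xJ k from rfl, h2]
    have : (fun k => ((cv k : ℤ) : ℚ)) = (Int.castRingHom ℚ) ∘ cv := rfl
    rw [this, hGq, ← RingHom.mapMatrix_apply, ← RingHom.map_adjugate, RingHom.mapMatrix_apply,
      ← RingHom.map_mulVec, eq_intCast]
  -- the integer vector
  set yJ : J → ℤ := G.adjugate.mulVec cv with hyJ
  set y : Fin p → ℤ := fun k => if hk : k = k₀ then G.det else
    if hJ' : k ∈ J then yJ ⟨k, hJ'⟩ else 0 with hy
  have hycast : ∀ k, ((y k : ℤ) : ℚ) = (G.det : ℚ) * x k := by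
    intro k
    by_cases hk : k = k₀
    · subst hk; simp [hy, hx0]
    · by_cases hkJ : k ∈ J
      · simp only [hy, dif_neg hk, dif_pos hkJ]
        rw [hdetx ⟨k, hkJ⟩]
      · have hxk : x k = 0 := by
          by_contra hne
          exact hkJ (Finset.mem_erase.2 ⟨hk, mem_supp.2 hne⟩)
        simp [hy, hk, hkJ, hxk]
  refine ⟨y, ?_, ?_, ?_⟩
  · -- `A y = 0`
    ext i
    have h1 : ((A.mulVec y i : ℤ) : ℚ) = (G.det : ℚ) * Aq.mulVec x i := by
      simp only [Matrix.mulVec, dotProduct, Int.cast_sum, Int.cast_mul, hycast, Finset.mul_sum, hAq,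
        Matrix.map_apply, eq_intCast]
      exact Finset.sum_congr rfl fun k _ => by ring
    rw [hx, Pi.zero_apply, mul_zero] at h1
    exact_mod_cast h1
  · -- `y k₀ ≠ 0`
    simp only [hy, dif_pos rfl]; exact hdet0
  · -- bounds
    intro k
    set r := Fintype.card J with hr
    have hrp : r + 1 ≤ p := by
      have : J.card < (Finset.univ : Finset (Fin p)).card :=
        Finset.card_lt_card ((Finset.ssubset_iff_of_subset (Finset.subset_univ _)).2
          ⟨k₀, Finset.mem_univ _, Finset.notMem_erase _ _⟩)
      rw [Finset.card_univ, Fintype.card_fin] at this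
      rw [hr, Fintype.card_coe]; omega
    set X : ℤ := m * H ^ 2 + 1 with hX
    have hH0 : (0 : ℤ) ≤ H := by exact_mod_cast Nat.zero_le H
    have hX1 : 1 ≤ X := by rw [hX]; nlinarith [sq_nonneg (H : ℤ)]
    have hX0 : 0 ≤ X := le_trans zero_le_one hX1
    -- entry bounds
    have hAJ' : ∀ i (k : J), |AJ i k| ≤ H := fun i k => by rw [hAJ]; exact hH i k
    have hGent : ∀ k k' : J, |G k k'| ≤ X := by
      intro k k'
      rw [hG, Matrix.mul_apply']
      refine (abs_dotProduct_le _ _ (U := H) (V := H) (fun i => ?_) (fun i => hAJ' i k')).trans ?_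
      · rw [Matrix.transpose_apply]; exact hAJ' i k
      · rw [Fintype.card_fin, hX]; nlinarith
    have hcv' : ∀ k : J, |cv k| ≤ X := by
      intro k
      rw [hcv]
      change |(fun i => AJ.transpose k i) ⬝ᵥ b| ≤ X
      refine (abs_dotProduct_le _ _ (U := H) (V := H) (fun i => ?_) (fun i => ?_)).trans ?_
      · rw [Matrix.transpose_apply]; exact hAJ' i k
      · rw [hb, abs_neg]; exact hH i k₀
      · rw [Fintype.card_fin, hX]; nlinarith
    have hdetb : |G.det| ≤ r.factorial * X ^ r := by rw [hr]; exact abs_det_le G hGent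
    have hadj : ∀ k j : J, |G.adjugate k j| ≤ r.factorial * X ^ r := fun k j => by
      rw [hr]; exact abs_adjugate_le G hX1 hGent k j
    have hyJb : ∀ k : J, |yJ k| ≤ (r + 1).factorial * X ^ (r + 1) := by
      intro k
      rw [hyJ]
      change |(fun j => G.adjugate k j) ⬝ᵥ cv| ≤ _
      refine (abs_dotProduct_le _ _ (fun j => hadj k j) hcv').trans ?_
      rw [← hr, Nat.factorial_succ, pow_succ]
      push_cast
      have h0 : (0 : ℤ) ≤ r.factorial * X ^ r * X := by positivity
      nlinarith
    -- the final comparison `(r+1)! X^(r+1) ≤ p! X^p`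
    have hfin : ((r + 1).factorial : ℤ) * X ^ (r + 1) ≤ p.factorial * X ^ p := by
      have h1 : ((r + 1).factorial : ℤ) ≤ p.factorial := by exact_mod_cast Nat.factorial_le hrp
      have h2 : X ^ (r + 1) ≤ X ^ p := pow_le_pow_right₀ hX1 hrp
      exact mul_le_mul h1 h2 (by positivity) (by positivity)
    have hfin' : (r.factorial : ℤ) * X ^ r ≤ p.factorial * X ^ p := by
      have h1 : (r.factorial : ℤ) ≤ p.factorial := by exact_mod_cast Nat.factorial_le (by omega)
      have h2 : X ^ r ≤ X ^ p := pow_le_pow_right₀ hX1 (by omega)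
      exact mul_le_mul h1 h2 (by positivity) (by positivity)
    by_cases hk : k = k₀
    · subst hk; simp only [hy, dif_pos rfl]; exact hdetb.trans hfin'
    · by_cases hkJ : k ∈ J
      · simp only [hy, dif_neg hk, dif_pos hkJ]; exact (hyJb _).trans hfin
      · simp only [hy, dif_neg hk, dif_neg hkJ, abs_zero]; positivity

end Literature.LinearAlgebra.Matrix

end
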